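import Literature.Analysis.Complex.DbarPoincarePolydisc
import Mathlib.Analysis.LocallyConvex.Separation
import HarnessLib

/-!
# Convex open subsets of `ℂ^ι` are exhausted by compact affine polyhedra

Geometric input for the passage from polydiscs to convex open sets in the vanishing of Dolbeault
cohomology (`Literature.NumberTheory.Transcendental.subsingleton_dolbeaultCohomology_of_convex`,
Hörmander (1973), §2.7): the analogue, for CONVEX sets and AFFINE functions, of Hörmander's
Lemma 2.7.4 (a polynomially convex compact set has a fundamental system of neighbourhoods which are
polynomial polyhedra).

* `exists_affine_norm_lt_one_and_one_lt` — for `U ⊆ ℂ^ι` open convex, `K ⊆ U` compact and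
  `y ∉ U` there is a complex AFFINE function `z ↦ L z + b` (`L` continuous `ℂ`-linear) with
  `‖L z + b‖ < 1` on `K` and `‖L y + b‖ > 1` (Hahn–Banach separation of `y` from the open convex
  `U`, `Re f < Re f(y)` on `U`, and the elementary "modulus trick" `P = f - f(y) + R + δ` with `R`
  large, which turns the half-plane condition into a disc condition);
* `exists_affinePolyhedron_between` — for `U` open convex and `K ⊆ U` compact there are a
  polydisc `D(c,r)` (`0 < r`) and finitely many affine functions `L_j + b_j` with
  `K ⊆ {z ∈ D(c,r) | ∀ j, ‖L_j z + b_j‖ < 1}` (open) and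
  `{z ∈ D̄(c,r) | ∀ j, ‖L_j z + b_j‖ ≤ 1} ⊆ U` (compact) — Hörmander's Lemma 2.7.4 for convex sets,
  by the Borel–Lebesgue argument of loc. cit. applied to `D̄(c,r) \ U`;
* `exists_affinePolyhedron_exhaustion` — **Theorem.** a convex open `U ⊆ ℂ^ι` is the increasing
  union of compact affine polyhedra `K_j = {z ∈ D̄(c_j,r_j) | ∀ l, ‖L_{j,l} z + b_{j,l}‖ ≤ 1} ⊆ U`
  with `K_j ⊆ interior K_{j+1}` (the exhaustion used in Hörmander's proof of Thm. 2.7.8).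

The affine polyhedra are the sets `μ⁻¹(D̄ × D̄^m)` for the AFFINE Oka map
`μ(z) = (z, L_1 z + b_1, …, L_m z + b_m)` (Hörmander (1973), Lemma 2.7.5, Thm. 2.7.6), so that
Oka's lemma applies to them with polynomial (indeed affine) `P_j`.

## References

* L. Hörmander, *An Introduction to Complex Analysis in Several Variables*, 2nd ed. (1973),
  Lemma 2.7.4, proof of Thm. 2.7.8. [HormanderSCV1973]
-/

noncomputable section

open Set Filter Function Complex Metric
open scoped Topology

namespace Literature.Analysis.Complex

variable {ι : Type*} [Fintype ι]

/-! ### Affine separation with control of the modulus -/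

omit [Fintype ι] in
/-- **Affine separation of a point outside an open convex set from a compact subset, in modulus.**
If `U ⊆ ℂ^ι` is open and convex, `K ⊆ U` is compact and `y ∉ U`, there is a complex affine
function `z ↦ L z + b` with `‖L z + b‖ < 1` for `z ∈ K` and `1 < ‖L y + b‖`. Proof: Hahn–Banach
gives a continuous `ℂ`-linear `f` with `Re f < Re f(y)` on `U`; on the compact `K`,
`Re (f - f(y)) ≤ -2δ < 0` and `f - f(y)` is bounded, so for `R` large the affine function
`P = f - f(y) + R + δ` has `|P|² ≤ (R - δ)² + B² < R²` on `K` while `P(y) = R + δ > R`; take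
`(L, b) = P / R`. (The convex-set analogue of the polynomial convexity of convex compacta,
Hörmander (1973), §2.7, used in Lemma 2.7.4.) [cite: HormanderSCV1973, Lemma 2.7.4] -/
theorem exists_affine_norm_lt_one_and_one_lt {U : Set (ι → ℂ)} (hUo : IsOpen U)
    (hUc : Convex ℝ U) {K : Set (ι → ℂ)} (hK : IsCompact K) (hKU : K ⊆ U) {y : ι → ℂ}
    (hy : y ∉ U) :
    ∃ (L : (ι → ℂ) →L[ℂ] ℂ) (b : ℂ), (∀ z ∈ K, ‖L z + b‖ < 1) ∧ 1 < ‖L y + b‖ := by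
  obtain ⟨f, hf⟩ := RCLike.geometric_hahn_banach_open_point (𝕜 := ℂ) hUc hUo hy
  -- the translated functional `g = f - f y`: `Re g < 0` on `U`, `g y = 0`
  set g : (ι → ℂ) → ℂ := fun z => f z - f y with hg
  have hgc : Continuous g := f.continuous.sub continuous_const
  have hgU : ∀ z ∈ U, (g z).re < 0 := fun z hz => by
    have := hf z hz
    simp only [hg, sub_re, sub_neg]
    exact this
  -- bounds on the compact set `K`
  obtain ⟨C, hC⟩ := hK.exists_bound_of_continuousOn (f := fun z => (g z).re)
    (continuous_re.comp hgc).continuousOn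
  obtain ⟨B, hB⟩ := hK.exists_bound_of_continuousOn (f := fun z => (g z).im)
    (continuous_im.comp hgc).continuousOn
  obtain ⟨δ, hδ, hδK⟩ : ∃ δ : ℝ, 0 < δ ∧ ∀ z ∈ K, (g z).re ≤ -(2 * δ) := by
    by_cases hKe : K.Nonempty
    · obtain ⟨z₀, hz₀, hmax⟩ := hK.exists_isMaxOn hKe (continuous_re.comp hgc).continuousOn
      have h0 : (g z₀).re < 0 := hgU z₀ (hKU hz₀)
      refine ⟨-(g z₀).re / 2, by linarith, fun z hz => ?_⟩
      have h1 : (g z).re ≤ (g z₀).re := hmax hz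
      linarith
    · exact ⟨1, one_pos, fun z hz => absurd ⟨z, hz⟩ hKe⟩
  -- the constant `R`
  set R : ℝ := max (max C 1) (δ + B ^ 2 / δ + 1) with hR
  have hRC : C ≤ R := (le_max_left C 1).trans (le_max_left _ _)
  have hR1 : (1 : ℝ) ≤ R := (le_max_right C 1).trans (le_max_left _ _)
  have hR0 : (0 : ℝ) < R := one_pos.trans_le hR1
  have hRδ : δ + B ^ 2 / δ < R := (lt_add_one _).trans_le (le_max_right _ _)
  have hkey : δ ^ 2 + B ^ 2 < R * δ := by
    have h1 : (δ + B ^ 2 / δ) * δ = δ ^ 2 + B ^ 2 := by field_simp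
    have h2 : (δ + B ^ 2 / δ) * δ < R * δ := mul_lt_mul_of_pos_right hRδ hδ
    linarith
  -- the affine function `P = (g + R + δ) / R`
  refine ⟨(R : ℂ)⁻¹ • f, (R : ℂ)⁻¹ * (-f y + (R + δ : ℝ)), fun z hz => ?_, ?_⟩
  · have hP : ((R : ℂ)⁻¹ • f) z + (R : ℂ)⁻¹ * (-f y + (R + δ : ℝ)) =
        (R : ℂ)⁻¹ * (g z + (R + δ : ℝ)) := by
      simp only [FunLike.coe_smul, Pi.smul_apply, smul_eq_mul, hg]
      ring
    rw [hP, norm_mul, norm_inv, Complex.norm_real, Real.norm_eq_abs, abs_of_pos hR0,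
      inv_mul_lt_iff₀ hR0, mul_one]
    -- `‖g z + (R + δ)‖ < R` via squares
    set w : ℂ := g z + (R + δ : ℝ) with hw
    have hwre : w.re = (g z).re + (R + δ) := by simp [hw]
    have hwim : w.im = (g z).im := by simp [hw]
    have hre1 : -C ≤ (g z).re := by
      have := hC z hz
      rw [Real.norm_eq_abs] at this
      exact (abs_le.1 this).1
    have hre2 : (g z).re ≤ -(2 * δ) := hδK z hz
    have him : |(g z).im| ≤ B := by
      have := hB z hz
      rwa [Real.norm_eq_abs] at this
    have hB0 : 0 ≤ B := (abs_nonneg _).trans him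
    have hwre0 : 0 ≤ w.re := by rw [hwre]; linarith
    have hwre1 : w.re ≤ R - δ := by rw [hwre]; linarith
    have hsq : ‖w‖ ^ 2 < R ^ 2 := by
      rw [Complex.sq_norm, Complex.normSq_apply]
      have h1 : w.re * w.re ≤ (R - δ) * (R - δ) := mul_self_le_mul_self hwre0 hwre1
      have h2 : w.im * w.im ≤ B * B := by
        rw [hwim]
        have := sq_le_sq' (abs_le.1 him).1 (abs_le.1 him).2
        nlinarith [this]
      nlinarith [h1, h2, hkey]
    exact (pow_lt_pow_iff_left₀ (norm_nonneg w) hR0.le two_ne_zero).1 hsq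
  · have hP : ((R : ℂ)⁻¹ • f) y + (R : ℂ)⁻¹ * (-f y + (R + δ : ℝ)) =
        (R : ℂ)⁻¹ * ((R + δ : ℝ) : ℂ) := by
      simp only [FunLike.coe_smul, Pi.smul_apply, smul_eq_mul]
      ring
    rw [hP, norm_mul, norm_inv, Complex.norm_real, Complex.norm_real, Real.norm_eq_abs,
      Real.norm_eq_abs, abs_of_pos hR0, abs_of_pos (by linarith), lt_inv_mul_iff₀ hR0, mul_one]
    linarith

/-! ### Affine polyhedra between a compact set and a convex open neighbourhood -/

/-- **Hörmander's Lemma 2.7.4 for convex sets.** Let `U ⊆ ℂ^ι` be open and convex and `K ⊆ U`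
compact. Then there are a polydisc `D(c, r)` with `0 < r_i` and finitely many complex affine
functions `L_j + b_j` (`j < m`) such that
`K ⊆ {z ∈ D(c,r) | ∀ j, ‖L_j z + b_j‖ < 1}` and `{z ∈ D̄(c,r) | ∀ j, ‖L_j z + b_j‖ ≤ 1} ⊆ U`.
Proof: choose `D ⊇ K`; the compact set `D̄ \ U` is covered by the open sets `{‖L_y · + b_y‖ > 1}`,
`y ∈ D̄ \ U`, of `exists_affine_norm_lt_one_and_one_lt` (Borel–Lebesgue, as in Hörmander (1973),
proof of Lemma 2.7.4). [cite: HormanderSCV1973, Lemma 2.7.4] -/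
theorem exists_affinePolyhedron_between {U : Set (ι → ℂ)} (hUo : IsOpen U) (hUc : Convex ℝ U)
    {K : Set (ι → ℂ)} (hK : IsCompact K) (hKU : K ⊆ U) :
    ∃ (c : ι → ℂ) (r : ι → ℝ) (m : ℕ) (L : Fin m → (ι → ℂ) →L[ℂ] ℂ) (b : Fin m → ℂ),
      (∀ i, 0 < r i) ∧
      K ⊆ {z ∈ polydisc c r | ∀ j, ‖L j z + b j‖ < 1} ∧
      {z ∈ Set.pi univ (fun i => closedBall (c i) (r i)) | ∀ j, ‖L j z + b j‖ ≤ 1} ⊆ U := by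
  -- a polydisc around `K`
  obtain ⟨R₀, hR₀⟩ := hK.isBounded.exists_norm_le
  set ρ : ℝ := max R₀ 0 + 1 with hρ
  have hρ0 : 0 < ρ := by rw [hρ]; positivity
  have hKD : K ⊆ polydisc (0 : ι → ℂ) (fun _ => ρ) := fun z hz => by
    refine mem_polydisc.2 fun i => mem_ball.2 ?_
    rw [Pi.zero_apply, dist_zero_right]
    calc ‖z i‖ ≤ ‖z‖ := norm_le_pi_norm z i
      _ ≤ R₀ := hR₀ z hz
      _ ≤ max R₀ 0 := le_max_left _ _
      _ < ρ := lt_add_one _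
  set D : Set (ι → ℂ) := Set.pi univ fun i => closedBall ((0 : ι → ℂ) i) ρ with hD
  have hDc : IsCompact D := isCompact_univ_pi fun i => isCompact_closedBall _ _
  -- the compact set `D \ U` and its cover
  have hT : IsCompact (D \ U) := hDc.diff hUo
  have hsep : ∀ y : ↥(D \ U), ∃ (L : (ι → ℂ) →L[ℂ] ℂ) (b : ℂ),
      (∀ z ∈ K, ‖L z + b‖ < 1) ∧ 1 < ‖L y + b‖ := fun y =>
    exists_affine_norm_lt_one_and_one_lt hUo hUc hK hKU y.2.2
  choose L b hLK hLy using hsep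
  set V : ↥(D \ U) → Set (ι → ℂ) := fun y => {z | 1 < ‖L y z + b y‖} with hV
  have hVo : ∀ y, IsOpen (V y) := fun y =>
    isOpen_lt continuous_const (((L y).continuous.add continuous_const).norm)
  have hcover : D \ U ⊆ ⋃ y, V y := fun z hz => mem_iUnion.2 ⟨⟨z, hz⟩, hLy ⟨z, hz⟩⟩
  obtain ⟨t, ht⟩ := hT.elim_finite_subcover V hVo hcover
  -- enumerate the finite subcover
  set m : ℕ := t.card with hm
  set e : Fin m → ↥(D \ U) := fun j => (t.equivFin.symm j : ↥t) with he
  refine ⟨0, fun _ => ρ, m, fun j => L (e j), fun j => b (e j), fun _ => hρ0, fun z hz => ?_,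
    fun z hz => ?_⟩
  · exact ⟨hKD hz, fun j => hLK (e j) z hz⟩
  · by_contra hzU
    obtain ⟨hzD, hzle⟩ := hz
    have hzT : z ∈ D \ U := ⟨hzD, hzU⟩
    obtain ⟨y, hy⟩ := mem_iUnion.1 (ht hzT)
    obtain ⟨hyt, hzy⟩ := mem_iUnion.1 hy
    have h1 : ‖L y z + b y‖ ≤ 1 := by simpa [he] using hzle (t.equivFin ⟨y, hyt⟩)
    exact absurd hzy (not_lt.2 h1)

omit [Fintype ι] in
/-- The compact affine polyhedron contains the open one. [folklore] -/
theorem affinePolyhedron_open_subset_closed (c : ι → ℂ) (r : ι → ℝ) {m : ℕ}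
    (L : Fin m → (ι → ℂ) →L[ℂ] ℂ) (b : Fin m → ℂ) :
    {z ∈ polydisc c r | ∀ j, ‖L j z + b j‖ < 1} ⊆
      {z ∈ Set.pi univ (fun i => closedBall (c i) (r i)) | ∀ j, ‖L j z + b j‖ ≤ 1} :=
  fun _ hz => ⟨polydisc_subset_pi_closedBall c r hz.1, fun j => (hz.2 j).le⟩

/-- The open affine polyhedron is open. [folklore] -/
theorem isOpen_affinePolyhedron_open (c : ι → ℂ) (r : ι → ℝ) {m : ℕ}
    (L : Fin m → (ι → ℂ) →L[ℂ] ℂ) (b : Fin m → ℂ) :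
    IsOpen {z ∈ polydisc c r | ∀ j, ‖L j z + b j‖ < 1} := by
  have h : {z ∈ polydisc c r | ∀ j, ‖L j z + b j‖ < 1} =
      polydisc c r ∩ ⋂ j, {z | ‖L j z + b j‖ < 1} := by
    ext z; simp [mem_iInter]
  rw [h]
  exact (isOpen_polydisc c r).inter (isOpen_iInter_of_finite fun j =>
    isOpen_lt (((L j).continuous.add continuous_const).norm) continuous_const)

omit [Fintype ι] in
/-- The compact affine polyhedron is compact. [folklore] -/
theorem isCompact_affinePolyhedron_closed (c : ι → ℂ) (r : ι → ℝ) {m : ℕ}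
    (L : Fin m → (ι → ℂ) →L[ℂ] ℂ) (b : Fin m → ℂ) :
    IsCompact {z ∈ Set.pi univ (fun i => closedBall (c i) (r i)) | ∀ j, ‖L j z + b j‖ ≤ 1} := by
  have h : {z ∈ Set.pi univ (fun i => closedBall (c i) (r i)) | ∀ j, ‖L j z + b j‖ ≤ 1} =
      (Set.pi univ fun i => closedBall (c i) (r i)) ∩ ⋂ j, {z | ‖L j z + b j‖ ≤ 1} := by
    ext z; simp [mem_iInter]
  rw [h]
  exact (isCompact_univ_pi fun i => isCompact_closedBall _ _).inter_right
    (isClosed_iInter fun j => isClosed_le (((L j).continuous.add continuous_const).norm)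
      continuous_const)

omit [Fintype ι] in
/-- The compact affine polyhedron is convex. [folklore] -/
theorem convex_affinePolyhedron_closed (c : ι → ℂ) (r : ι → ℝ) {m : ℕ}
    (L : Fin m → (ι → ℂ) →L[ℂ] ℂ) (b : Fin m → ℂ) :
    Convex ℝ {z ∈ Set.pi univ (fun i => closedBall (c i) (r i)) | ∀ j, ‖L j z + b j‖ ≤ 1} := by
  have h : {z ∈ Set.pi univ (fun i => closedBall (c i) (r i)) | ∀ j, ‖L j z + b j‖ ≤ 1} =
      (Set.pi univ fun i => closedBall (c i) (r i)) ∩ ⋂ j, {z | ‖L j z + b j‖ ≤ 1} := by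
    ext z; simp [mem_iInter]
  rw [h]
  refine (convex_pi fun i _ => convex_closedBall (c i) (r i)).inter (convex_iInter fun j => ?_)
  have h2 : {z : ι → ℂ | ‖L j z + b j‖ ≤ 1} =
      (fun z => L j z + b j) ⁻¹' closedBall (0 : ℂ) 1 := by
    ext z; simp
  rw [h2]
  exact (convex_closedBall (0 : ℂ) 1).affine_preimage
    (((L j).restrictScalars ℝ : (ι → ℂ) →ₗ[ℝ] ℂ).toAffineMap + AffineMap.const ℝ (ι → ℂ) (b j))

/-- The open affine polyhedron lies in the interior of the compact one. [folklore] -/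
theorem affinePolyhedron_open_subset_interior (c : ι → ℂ) (r : ι → ℝ) {m : ℕ}
    (L : Fin m → (ι → ℂ) →L[ℂ] ℂ) (b : Fin m → ℂ) :
    {z ∈ polydisc c r | ∀ j, ‖L j z + b j‖ < 1} ⊆
      interior {z ∈ Set.pi univ (fun i => closedBall (c i) (r i)) | ∀ j, ‖L j z + b j‖ ≤ 1} :=
  interior_maximal (affinePolyhedron_open_subset_closed c r L b)
    (isOpen_affinePolyhedron_open c r L b)

/-! ### A compact exhaustion of a convex open set by affine polyhedra -/

/-- Compact subsets `C_j = {‖x‖ ≤ j} ∩ {dist(x, Uᶜ) ≥ 1/(j+1)}` of an open set `U` with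
`⋃ C_j = U`. [folklore] -/
theorem exists_compact_cover_nat {U : Set (ι → ℂ)} (hUo : IsOpen U) :
    ∃ C : ℕ → Set (ι → ℂ), (∀ j, IsCompact (C j)) ∧ (∀ j, C j ⊆ U) ∧ U ⊆ ⋃ j, C j := by
  set C : ℕ → Set (ι → ℂ) := fun j =>
    closedBall 0 j ∩ {x | ∀ y ∈ Uᶜ, (1 : ℝ) / ((j : ℝ) + 1) ≤ dist x y} with hC
  refine ⟨C, fun j => ?_, fun j x hx => ?_, fun x hx => ?_⟩
  · refine (isCompact_closedBall (0 : ι → ℂ) j).inter_right ?_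
    have h : {x : ι → ℂ | ∀ y ∈ Uᶜ, (1 : ℝ) / ((j : ℝ) + 1) ≤ dist x y} =
        ⋂ y ∈ Uᶜ, {x | (1 : ℝ) / ((j : ℝ) + 1) ≤ dist x y} := by
      ext x; simp only [mem_setOf_eq, mem_iInter]
    rw [h]
    exact isClosed_biInter fun y _ => isClosed_le continuous_const (continuous_id.dist continuous_const)
  · by_contra hxU
    have := hx.2 x hxU
    rw [dist_self] at this
    exact absurd this (not_le.2 (by positivity))
  · obtain ⟨ε, hε, hεU⟩ := Metric.isOpen_iff.1 hUo x hx
    obtain ⟨j, hj⟩ := exists_nat_gt (max ‖x‖ (1 / ε))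
    refine mem_iUnion.2 ⟨j, ?_, fun y hy => ?_⟩
    · rw [mem_closedBall, dist_zero_right]
      exact ((le_max_left _ _).trans hj.le)
    · have hyx : ε ≤ dist x y := by
        by_contra h
        exact hy (hεU (mem_ball'.2 (not_le.1 h)))
      have h1 : 1 / ε < (j : ℝ) + 1 := ((le_max_right _ _).trans_lt hj).trans (lt_add_one _)
      have h2 : 1 / ((j : ℝ) + 1) < ε := by
        rw [div_lt_iff₀ (by positivity)]
        rw [div_lt_iff₀ hε] at h1
        linarith
      exact h2.le.trans hyx

/-- **Convex open sets are exhausted by compact affine polyhedra** (the exhaustion of Hörmander's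
proof of Thm. 2.7.8, for convex `Ω`, with the polyhedra of Lemma 2.7.4 taken affine): for
`U ⊆ ℂ^ι` open and convex there are compact affine polyhedra
`K_j = {z ∈ D̄(c_j, r_j) | ∀ l, ‖L_{j,l} z + b_{j,l}‖ ≤ 1} ⊆ U` (`0 < r_j`) with
`K_j ⊆ interior K_{j+1}` and `U = ⋃_j K_j`. [cite: HormanderSCV1973, Lemma 2.7.4] -/
theorem exists_affinePolyhedron_exhaustion {U : Set (ι → ℂ)} (hUo : IsOpen U) (hUc : Convex ℝ U) :
    ∃ K : ℕ → Set (ι → ℂ),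
      (∀ j, ∃ (c : ι → ℂ) (r : ι → ℝ) (m : ℕ) (L : Fin m → (ι → ℂ) →L[ℂ] ℂ) (b : Fin m → ℂ),
        (∀ i, 0 < r i) ∧
        K j = {z ∈ Set.pi univ (fun i => closedBall (c i) (r i)) | ∀ l, ‖L l z + b l‖ ≤ 1}) ∧
      (∀ j, IsCompact (K j)) ∧ (∀ j, K j ⊆ U) ∧ (∀ j, K j ⊆ interior (K (j + 1))) ∧
      U ⊆ ⋃ j, K j := by
  obtain ⟨C, hCc, hCU, hUC⟩ := exists_compact_cover_nat hUo
  -- admissible sets: compact affine polyhedra inside `U`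
  let Adm : Set (ι → ℂ) → Prop := fun S =>
    (∃ (c : ι → ℂ) (r : ι → ℝ) (m : ℕ) (L : Fin m → (ι → ℂ) →L[ℂ] ℂ) (b : Fin m → ℂ),
      (∀ i, 0 < r i) ∧
      S = {z ∈ Set.pi univ (fun i => closedBall (c i) (r i)) | ∀ l, ‖L l z + b l‖ ≤ 1}) ∧
    IsCompact S ∧ S ⊆ U
  -- the step: an admissible set containing a given compact subset of `U` in its interior
  have step : ∀ S : Set (ι → ℂ), IsCompact S → S ⊆ U → ∃ S', Adm S' ∧ S ⊆ interior S' := by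
    intro S hS hSU
    obtain ⟨c, r, m, L, b, hr, hK, hPU⟩ := exists_affinePolyhedron_between hUo hUc hS hSU
    exact ⟨_, ⟨⟨c, r, m, L, b, hr, rfl⟩, isCompact_affinePolyhedron_closed c r L b, hPU⟩,
      hK.trans (affinePolyhedron_open_subset_interior c r L b)⟩
  have step' : ∀ (j : ℕ) (S : Set (ι → ℂ)), Adm S → ∃ S', Adm S' ∧ S ∪ C (j + 1) ⊆ interior S' :=
    fun j S hS => step (S ∪ C (j + 1)) (hS.2.1.union (hCc _)) (union_subset hS.2.2 (hCU _))
  obtain ⟨S₀, hS₀, hCS₀⟩ := step (C 0) (hCc 0) (hCU 0)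
  let K : ∀ j : ℕ, {S // Adm S} := fun j =>
    Nat.rec (motive := fun _ => {S // Adm S}) ⟨S₀, hS₀⟩
      (fun j s => ⟨Classical.choose (step' j s.1 s.2), (Classical.choose_spec (step' j s.1 s.2)).1⟩) j
  have hKsucc : ∀ j, (K j).1 ∪ C (j + 1) ⊆ interior (K (j + 1)).1 := fun j =>
    (Classical.choose_spec (step' j (K j).1 (K j).2)).2
  refine ⟨fun j => (K j).1, fun j => (K j).2.1, fun j => (K j).2.2.1, fun j => (K j).2.2.2,
    fun j => subset_union_left.trans (hKsucc j), fun x hx => ?_⟩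
  obtain ⟨j, hj⟩ := mem_iUnion.1 (hUC hx)
  refine mem_iUnion.2 ⟨j, ?_⟩
  cases j with
  | zero => exact interior_subset (hCS₀ hj)
  | succ j => exact interior_subset (hKsucc j (subset_union_right hj))

end Literature.Analysis.Complex
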